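import Summits.CriticalPhenomena.PercolationContinuityZ3.Theorems.Transplant.SkelNegBParamsFaceFloorsAXA
import Summits.CriticalPhenomena.PercolationContinuityZ3.Theorems.Transplant.SkelNegBParamsFaceBandRoomA
import Summits.CriticalPhenomena.PercolationContinuityZ3.Theorems.Transplant.SkelNegBParamsFaceRunA
import Summits.CriticalPhenomena.PercolationContinuityZ3.Theorems.Transplant.SkelPhiFaceNumsYFace
import HarnessLib

/-!
# N1 params, M3 y′-FACE, group G-T′ — **THE y′-FACE's TANGENTIAL x-RUN FLOORS `FT1`–`FT6`** (fields `Skelφ.FloorsY2.FT1–FT6`, SkelPhiFaceNumsYP2) at the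
# (ζ′) tuple in M3-FLOORS-SIGNATURE form (`pr := prFA`: `coarse c₀ (D/2) D (lam0 A v_L v_β y) = KS.FcA y`, `coarse c₁ (D/2) D (lam1 A n_L h_L y) = KS.F1cA y` (rfl);
# `P := fcellsA`, `κ₀ := u₀A`, `κ₁ := u₁A`, `mod := m := modulus n_L h_L v_L v_β`, `Vb := n_L`, `ℓ' := ℓ_L`, `R'₃ := RA′ mk`, `qB₃ := qB3YA (RA′ mk) = 2n_L + 1000·Kq·RA′`,
# `k₀ := 3`), for the y′-face (`du.1 = 1`: the face's ALONG axis is `1` — habitat `[flo, fhi] = [5r₁ + 10u₁j + 3 − lev, 25r₁ − 2 − lev]` — and its transverse axis is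
# `i := oth du.1 = 0`, room `fw = 5r_i − 7 − |z_i − cen_i|`), the tangential run starting at ANY `yT` (the integrator takes `yT := yL + crossOffY …`) with sign `σT = ±1`:
# * **`FT1_YA`–`FT4_YA`** (axis `1` = the x-run's level direction: region `k`'s reading is `F1cA yT ± 4.5u₁` by the slant `KS.slant_le`, `k + 1 ≤ 1000·Kq`): from the
#   run-position facts `hnear : flo + 5u₁ + 1 ≤ ±F1cA yT`, `hfar : ±F1cA yT + 5u₁ + 1 ≤ fhi` (the y′-run's end sits at the along target `20r₁ − lev ± 2u₁`, deep inside);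
# * **`FT5_YA`/`FT6_YA`** (axis `0` = the x-run's along direction: region `k`'s reading is `FcA yT + σT·u₀·k ± (4u₀ + 4.5u₀ + 1)` by **`xSBox_eq`**
#   (`xSLo/xSHi = σT·k·n ∓ (qB₃ + (k+1)R′ + n)`, `qB₃ + (k+1)RA′ + n ≤ 4n_L` under `2000·Kq·(RA′+2) ≤ n_L`) and the slant): from `hlo : −fw + 10u₀ + 2 ≤ FcA yT + σT·u₀·k`,
#   `hhi : FcA yT + σT·u₀·k + 10u₀ + 2 ≤ fw`; the band room for them is **`hkE24_RA₂ : 2·kFF₂ + 24u + 24 ≤ 5r`** (`Rl ≤ 2RA′`).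
# (stmt-g17 2026-08-22; y′-face split: hp-8 g36 08:48:44Z, lead 06:53:24Z/07:03:26Z.)
builds on p205010 (kernel theorem, internal audit signed; external expert review pending) — nothing in this file uses p205010; NOTHING is claimed about the node
`SamePDropOfSkeletonNeg₁` (OPEN); arithmetic only.
Lane `prim-bschramm-*`, seat `prim-bschramm-stmt` (gen 17); helper file (`--supports stmt-CriticalPhenomena-4575 --as helper`); slot-ledger ζ′ v2.
[cite: KozmaNitzan2024, §4 Lemma 12 (pp. 23–25)] [cite: MartineauTassion2017, §4.1]
-/

noncomputable section

open scoped Classical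

namespace Summit.CriticalPhenomena.PercolationContinuityZ3.Theorems.Transplant

namespace PlanarSkeletonNeg

namespace NegB

open Literature.Probability.Percolation Literature.Probability.LatticeModels SimpleGraph
open SkelConc (Consts)
open Skelφ (shearUnit xBoxB xBoxLoA xBoxHiA xSLo xSHi)
open Skelφ.StepI (DataN)
open TwoAxis.Para (modulus)
open Neg

namespace KS

/-! ## §1 The signed along boxes of a tangential x-run and the band room -/

/-- **The signed along ends of region `k` of an x-run** (`τ = ±1`): `xSLo n q R′ τ k = τ·k·n − (q + (k+1)R′ + n)` and `xSHi … = τ·k·n + (q + (k+1)R′ + n)`. [folklore] -/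
theorem xSBox_eq (n q R' k : ℕ) {τ : ℤ} (hτ : τ = 1 ∨ τ = -1) :
    xSLo n q R' τ k = τ * ((k : ℤ) * n) - ((q : ℤ) + ((k : ℤ) + 1) * R' + n) ∧
      xSHi n q R' τ k = τ * ((k : ℤ) * n) + ((q : ℤ) + ((k : ℤ) + 1) * R' + n) := by
  have hkR : (0 : ℤ) ≤ (k : ℤ) * R' := mul_nonneg (Nat.cast_nonneg _) (Nat.cast_nonneg _)
  have hq : (0 : ℤ) ≤ (q : ℤ) := Nat.cast_nonneg _
  have hR : (0 : ℤ) ≤ (R' : ℤ) := Nat.cast_nonneg _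
  have hn : (0 : ℤ) ≤ (n : ℤ) := Nat.cast_nonneg _
  have hle : xBoxLoA n q R' k ≤ xBoxHiA n q R' k := by unfold Skelφ.xBoxLoA Skelφ.xBoxHiA; linarith
  rcases hτ with rfl | rfl
  · unfold Skelφ.xSLo Skelφ.xSHi
    rw [one_mul, one_mul, min_eq_left hle, max_eq_right hle]
    unfold Skelφ.xBoxLoA Skelφ.xBoxHiA
    constructor <;> ring
  · unfold Skelφ.xSLo Skelφ.xSHi
    simp only [neg_mul, one_mul]
    rw [min_eq_right (neg_le_neg hle), max_eq_left (neg_le_neg hle)]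
    unfold Skelφ.xBoxLoA Skelφ.xBoxHiA
    constructor <;> ring

section Band24

variable (κ : Consts) {V : Type} [DecidableEq V] [Countable V] {G : SimpleGraph V} [G.LocallyFinite] (Φ : PlanarSkeletonNeg G) (t : V)
  (p : unitInterval) (D : DataN V) (f mk : ℕ) (gx : Neg.FSlot)

/-- **`2·kFF₂ + 24·u + 24 ≤ 5·r_(oth I)` for every `Rl ≤ 2·RA′`** (the y′-face's tangential room: `kFF₂ ≤ 2r + 5Rl + 15`, `6RA′ + 11 ≤ u`, `40u ≤ r`).
[cite: KozmaNitzan2024, §4 Lemma 12 (pp. 23–25)] -/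
theorem hkE24_RA₂ (hN : EqNumL κ Φ t p D (gT mk gx κ Φ t p D) f) (hκ : (hL κ Φ t p D (gT mk gx κ Φ t p D) f).natAbs ≤ 10 * nL κ Φ t p D (gT mk gx κ Φ t p D) f)
    {Rl : ℕ} (hRl : Rl ≤ 2 * RA' κ Φ t p D mk) (I : Fin 2) :
    2 * (prFA κ Φ t p D (gT mk gx κ Φ t p D) f).kFF₂ (fcellsA κ Φ t p D (gT mk gx κ Φ t p D) f) Rl I +
        24 * (if Literature.Probability.Percolation.KozmaNitzan.Cells.oth I = 0 then u₀A κ Φ t p D (gT mk gx κ Φ t p D) f else u₁A κ Φ t p D (gT mk gx κ Φ t p D) f) + 24 ≤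
      5 * ((fcellsA κ Φ t p D (gT mk gx κ Φ t p D) f).r (Literature.Probability.Percolation.KozmaNitzan.Cells.oth I) : ℤ) := by
  have hq := kFF₂_le_linA κ Φ t p D f mk gx hN hκ Rl I
  obtain ⟨-, hu, hru⟩ := uA_oth_facts κ Φ t p D f mk gx hN hκ I
  have hRl' : (Rl : ℤ) ≤ 2 * RA' κ Φ t p D mk := by exact_mod_cast hRl
  have hR0 : (0 : ℤ) ≤ (RA' κ Φ t p D mk : ℤ) := Nat.cast_nonneg _
  set q := (prFA κ Φ t p D (gT mk gx κ Φ t p D) f).kFF₂ (fcellsA κ Φ t p D (gT mk gx κ Φ t p D) f) Rl I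
  set u := (if Literature.Probability.Percolation.KozmaNitzan.Cells.oth I = 0 then u₀A κ Φ t p D (gT mk gx κ Φ t p D) f else u₁A κ Φ t p D (gT mk gx κ Φ t p D) f)
  set r := ((fcellsA κ Φ t p D (gT mk gx κ Φ t p D) f).r (Literature.Probability.Percolation.KozmaNitzan.Cells.oth I) : ℤ)
  linarith

end Band24

/-! ## §2 The floors -/

section FloorsTY

variable (κ : Consts) {V : Type} [DecidableEq V] [Countable V] {G : SimpleGraph V} [G.LocallyFinite] (Φ : PlanarSkeletonNeg G) (t : V)
  (p : unitInterval) (D : DataN V) (g f mk : ℕ)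

/-- `2 ≤ m` under the numeric long clause and `22000·Kq·(RA′+2) ≤ ℓ_L` (`m > n_Lℓ_L − n_L ≥ ℓ_L − 1`). [folklore] -/
theorem two_le_modulus (hN : EqNumL κ Φ t p D g f)
    (hℓ : 22000 * Neg.Kq κ * (RA' κ Φ t p D mk + 2) ≤ ℓL κ Φ t p D g f) :
    2 ≤ modulus (nL κ Φ t p D g f) (hL κ Φ t p D g f) (vL κ Φ t p D g f) (vβL κ Φ t p D g f) := by
  obtain ⟨hn1, hℓ1⟩ := one_le_of_eqNumL κ Φ t p D g f hN
  have hm := (Skelφ.NegPrm.modulus_vβOf hn1 (hL κ Φ t p D g f) (ℓL κ Φ t p D g f) (vL κ Φ t p D g f)).1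
  have e : vβL κ Φ t p D g f = Skelφ.NegPrm.vβOf (nL κ Φ t p D g f) (hL κ Φ t p D g f) (ℓL κ Φ t p D g f) (vL κ Φ t p D g f) := rfl
  rw [← e] at hm
  have hℓ' : 22000 * (Neg.Kq κ : ℤ) * ((RA' κ Φ t p D mk : ℤ) + 2) ≤ (ℓL κ Φ t p D g f : ℤ) := by exact_mod_cast hℓ
  have hKq : (1 : ℤ) ≤ (Neg.Kq κ : ℤ) := by exact_mod_cast Neg.one_le_Kq κ
  have hR0 : (0 : ℤ) ≤ (RA' κ Φ t p D mk : ℤ) := Nat.cast_nonneg _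
  have hn : (1 : ℤ) ≤ (nL κ Φ t p D g f : ℤ) := by exact_mod_cast hn1
  have hKR : (0 : ℤ) ≤ (Neg.Kq κ : ℤ) * (RA' κ Φ t p D mk : ℤ) := mul_nonneg (by linarith) hR0
  have h1 : (1 : ℤ) * ((ℓL κ Φ t p D g f : ℤ) - 1) ≤ (nL κ Φ t p D g f : ℤ) * ((ℓL κ Φ t p D g f : ℤ) - 1) :=
    mul_le_mul_of_nonneg_right hn (by nlinarith)
  nlinarith

/-- **`FT1` at the (ζ′) y′-face tuple** (`σ = 1`): the lower axis-`1` reading of tangential region `k` is above `flo`, given `hnear : flo + 5u₁ + 1 ≤ F1cA yT`.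
[cite: KozmaNitzan2024, §4 Lemma 12 (pp. 23–25)] -/
theorem FT1_YA (hN : EqNumL κ Φ t p D g f) (hκ : (hL κ Φ t p D g f).natAbs ≤ 10 * nL κ Φ t p D g f)
    (hℓ : 22000 * Neg.Kq κ * (RA' κ Φ t p D mk + 2) ≤ ℓL κ Φ t p D g f) (yT : Site 2) {lev : ℤ} {j k : ℕ} (hk : k + 1 ≤ 1000 * Neg.Kq κ)
    (hnear : 5 * ((fcellsA κ Φ t p D g f).r 1 : ℤ) + 10 * u₁A κ Φ t p D g f * (j : ℤ) + 3 - lev + 5 * u₁A κ Φ t p D g f + 1 ≤ F1cA κ Φ t p D g f yT) :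
    modulus (nL κ Φ t p D g f) (hL κ Φ t p D g f) (vL κ Φ t p D g f) (vβL κ Φ t p D g f) *
        ((5 * ((fcellsA κ Φ t p D g f).r 1 : ℤ) + 10 * u₁A κ Φ t p D g f * (j : ℤ) + 3 - lev) - F1cA κ Φ t p D g f yT) ≤
      -(u₁A κ Φ t p D g f * (shearUnit (nL κ Φ t p D g f) (hL κ Φ t p D g f) : ℤ) *
          (xBoxB (nL κ Φ t p D g f) (ℓL κ Φ t p D g f) (hL κ Φ t p D g f) (RA' κ Φ t p D mk) k + 1)) -
        modulus (nL κ Φ t p D g f) (hL κ Φ t p D g f) (vL κ Φ t p D g f) (vβL κ Φ t p D g f) + 1 := by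
  obtain ⟨hn1, hℓ1⟩ := one_le_of_eqNumL κ Φ t p D g f hN
  have hm2 := two_le_modulus κ Φ t p D g f mk hN hℓ
  have hu : 1 ≤ u₁A κ Φ t p D g f := (units_eqA κ Φ t p D g f).2.2.2.2.2.2.2
  have hsl := slant_le κ Φ t p D g f mk hN hκ hℓ hk (by linarith : 0 ≤ u₁A κ Φ t p D g f)
  clear hℓ hk hκ
  set m := modulus (nL κ Φ t p D g f) (hL κ Φ t p D g f) (vL κ Φ t p D g f) (vβL κ Φ t p D g f)
  set u := u₁A κ Φ t p D g f
  set F := F1cA κ Φ t p D g f yT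
  set S := (shearUnit (nL κ Φ t p D g f) (hL κ Φ t p D g f) : ℤ) * (xBoxB (nL κ Φ t p D g f) (ℓL κ Φ t p D g f) (hL κ Φ t p D g f) (RA' κ Φ t p D mk) k + 1)
  set flo := 5 * ((fcellsA κ Φ t p D g f).r 1 : ℤ) + 10 * u * (j : ℤ) + 3 - lev
  have h1 : m * (flo - F) ≤ m * (-(5 * u) - 1) := mul_le_mul_of_nonneg_left (by linarith) (by linarith)
  have h2 : (1 : ℤ) * 2 ≤ u * m := mul_le_mul hu hm2 (by norm_num) (by linarith)
  nlinarith

/-- **`FT2` at the (ζ′) y′-face tuple** (`σ = 1`): the upper axis-`1` reading of tangential region `k` is below `fhi`, given `hfar : F1cA yT + 5u₁ + 1 ≤ fhi`.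
[cite: KozmaNitzan2024, §4 Lemma 12 (pp. 23–25)] -/
theorem FT2_YA (hN : EqNumL κ Φ t p D g f) (hκ : (hL κ Φ t p D g f).natAbs ≤ 10 * nL κ Φ t p D g f)
    (hℓ : 22000 * Neg.Kq κ * (RA' κ Φ t p D mk + 2) ≤ ℓL κ Φ t p D g f) (yT : Site 2) {lev : ℤ} {k : ℕ} (hk : k + 1 ≤ 1000 * Neg.Kq κ)
    (hfar : F1cA κ Φ t p D g f yT + 5 * u₁A κ Φ t p D g f + 1 ≤ 25 * ((fcellsA κ Φ t p D g f).r 1 : ℤ) - 2 - lev) :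
    modulus (nL κ Φ t p D g f) (hL κ Φ t p D g f) (vL κ Φ t p D g f) (vβL κ Φ t p D g f) * (F1cA κ Φ t p D g f yT + 1) +
        u₁A κ Φ t p D g f * ((shearUnit (nL κ Φ t p D g f) (hL κ Φ t p D g f) : ℤ) *
            xBoxB (nL κ Φ t p D g f) (ℓL κ Φ t p D g f) (hL κ Φ t p D g f) (RA' κ Φ t p D mk) k +
          shearUnit (nL κ Φ t p D g f) (hL κ Φ t p D g f) - 1) ≤
      modulus (nL κ Φ t p D g f) (hL κ Φ t p D g f) (vL κ Φ t p D g f) (vβL κ Φ t p D g f) * (25 * ((fcellsA κ Φ t p D g f).r 1 : ℤ) - 2 - lev) := by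
  obtain ⟨hn1, hℓ1⟩ := one_le_of_eqNumL κ Φ t p D g f hN
  have hm2 := two_le_modulus κ Φ t p D g f mk hN hℓ
  have hu : 1 ≤ u₁A κ Φ t p D g f := (units_eqA κ Φ t p D g f).2.2.2.2.2.2.2
  have hsl := slant_le κ Φ t p D g f mk hN hκ hℓ hk (by linarith : 0 ≤ u₁A κ Φ t p D g f)
  clear hℓ hk hκ
  set m := modulus (nL κ Φ t p D g f) (hL κ Φ t p D g f) (vL κ Φ t p D g f) (vβL κ Φ t p D g f)
  set u := u₁A κ Φ t p D g f
  set F := F1cA κ Φ t p D g f yT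
  set U : ℤ := (shearUnit (nL κ Φ t p D g f) (hL κ Φ t p D g f) : ℤ)
  set X := xBoxB (nL κ Φ t p D g f) (ℓL κ Φ t p D g f) (hL κ Φ t p D g f) (RA' κ Φ t p D mk) k
  set fhi := 25 * ((fcellsA κ Φ t p D g f).r 1 : ℤ) - 2 - lev
  have e : u * (U * X + U - 1) = u * (U * (X + 1)) - u := by ring
  have h1 : m * (F + 5 * u + 1) ≤ m * fhi := mul_le_mul_of_nonneg_left hfar (by linarith)
  rw [e]
  nlinarith

/-- **`FT3` at the (ζ′) y′-face tuple** (`σ = −1`): mirror of `FT1`, given `hnear : flo + 5u₁ + 1 ≤ −F1cA yT`. [cite: KozmaNitzan2024, §4 Lemma 12 (pp. 23–25)] -/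
theorem FT3_YA (hN : EqNumL κ Φ t p D g f) (hκ : (hL κ Φ t p D g f).natAbs ≤ 10 * nL κ Φ t p D g f)
    (hℓ : 22000 * Neg.Kq κ * (RA' κ Φ t p D mk + 2) ≤ ℓL κ Φ t p D g f) (yT : Site 2) {lev : ℤ} {j k : ℕ} (hk : k + 1 ≤ 1000 * Neg.Kq κ)
    (hnear : 5 * ((fcellsA κ Φ t p D g f).r 1 : ℤ) + 10 * u₁A κ Φ t p D g f * (j : ℤ) + 3 - lev + 5 * u₁A κ Φ t p D g f + 1 ≤ -F1cA κ Φ t p D g f yT) :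
    modulus (nL κ Φ t p D g f) (hL κ Φ t p D g f) (vL κ Φ t p D g f) (vβL κ Φ t p D g f) *
        ((5 * ((fcellsA κ Φ t p D g f).r 1 : ℤ) + 10 * u₁A κ Φ t p D g f * (j : ℤ) + 3 - lev) + F1cA κ Φ t p D g f yT + 1) ≤
      -(u₁A κ Φ t p D g f * ((shearUnit (nL κ Φ t p D g f) (hL κ Φ t p D g f) : ℤ) *
            xBoxB (nL κ Φ t p D g f) (ℓL κ Φ t p D g f) (hL κ Φ t p D g f) (RA' κ Φ t p D mk) k +
          shearUnit (nL κ Φ t p D g f) (hL κ Φ t p D g f) - 1)) := by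
  obtain ⟨hn1, hℓ1⟩ := one_le_of_eqNumL κ Φ t p D g f hN
  have hm2 := two_le_modulus κ Φ t p D g f mk hN hℓ
  have hu : 1 ≤ u₁A κ Φ t p D g f := (units_eqA κ Φ t p D g f).2.2.2.2.2.2.2
  have hsl := slant_le κ Φ t p D g f mk hN hκ hℓ hk (by linarith : 0 ≤ u₁A κ Φ t p D g f)
  clear hℓ hk hκ
  set m := modulus (nL κ Φ t p D g f) (hL κ Φ t p D g f) (vL κ Φ t p D g f) (vβL κ Φ t p D g f)
  set u := u₁A κ Φ t p D g f
  set F := F1cA κ Φ t p D g f yT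
  set U : ℤ := (shearUnit (nL κ Φ t p D g f) (hL κ Φ t p D g f) : ℤ)
  set X := xBoxB (nL κ Φ t p D g f) (ℓL κ Φ t p D g f) (hL κ Φ t p D g f) (RA' κ Φ t p D mk) k
  set flo := 5 * ((fcellsA κ Φ t p D g f).r 1 : ℤ) + 10 * u * (j : ℤ) + 3 - lev
  have e : u * (U * X + U - 1) = u * (U * (X + 1)) - u := by ring
  have h1 : m * (flo + F + 1) ≤ m * (-(5 * u)) := mul_le_mul_of_nonneg_left (by linarith) (by linarith)
  rw [e]
  nlinarith

/-- **`FT4` at the (ζ′) y′-face tuple** (`σ = −1`): mirror of `FT2`, given `hfar : −F1cA yT + 5u₁ + 1 ≤ fhi`. [cite: KozmaNitzan2024, §4 Lemma 12 (pp. 23–25)] -/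
theorem FT4_YA (hN : EqNumL κ Φ t p D g f) (hκ : (hL κ Φ t p D g f).natAbs ≤ 10 * nL κ Φ t p D g f)
    (hℓ : 22000 * Neg.Kq κ * (RA' κ Φ t p D mk + 2) ≤ ℓL κ Φ t p D g f) (yT : Site 2) {lev : ℤ} {k : ℕ} (hk : k + 1 ≤ 1000 * Neg.Kq κ)
    (hfar : -F1cA κ Φ t p D g f yT + 5 * u₁A κ Φ t p D g f + 1 ≤ 25 * ((fcellsA κ Φ t p D g f).r 1 : ℤ) - 2 - lev) :
    -(modulus (nL κ Φ t p D g f) (hL κ Φ t p D g f) (vL κ Φ t p D g f) (vβL κ Φ t p D g f) * F1cA κ Φ t p D g f yT) +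
          u₁A κ Φ t p D g f * (shearUnit (nL κ Φ t p D g f) (hL κ Φ t p D g f) : ℤ) *
            (xBoxB (nL κ Φ t p D g f) (ℓL κ Φ t p D g f) (hL κ Φ t p D g f) (RA' κ Φ t p D mk) k + 1) +
        modulus (nL κ Φ t p D g f) (hL κ Φ t p D g f) (vL κ Φ t p D g f) (vβL κ Φ t p D g f) - 1 ≤
      modulus (nL κ Φ t p D g f) (hL κ Φ t p D g f) (vL κ Φ t p D g f) (vβL κ Φ t p D g f) * (25 * ((fcellsA κ Φ t p D g f).r 1 : ℤ) - 2 - lev) := by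
  obtain ⟨hn1, hℓ1⟩ := one_le_of_eqNumL κ Φ t p D g f hN
  have hm2 := two_le_modulus κ Φ t p D g f mk hN hℓ
  have hu : 1 ≤ u₁A κ Φ t p D g f := (units_eqA κ Φ t p D g f).2.2.2.2.2.2.2
  have hsl := slant_le κ Φ t p D g f mk hN hκ hℓ hk (by linarith : 0 ≤ u₁A κ Φ t p D g f)
  clear hℓ hk hκ
  set m := modulus (nL κ Φ t p D g f) (hL κ Φ t p D g f) (vL κ Φ t p D g f) (vβL κ Φ t p D g f)
  set u := u₁A κ Φ t p D g f
  set F := F1cA κ Φ t p D g f yT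
  set S := (shearUnit (nL κ Φ t p D g f) (hL κ Φ t p D g f) : ℤ) * (xBoxB (nL κ Φ t p D g f) (ℓL κ Φ t p D g f) (hL κ Φ t p D g f) (RA' κ Φ t p D mk) k + 1)
  set fhi := 25 * ((fcellsA κ Φ t p D g f).r 1 : ℤ) - 2 - lev
  have h1 : m * (-F + 5 * u + 1) ≤ m * fhi := mul_le_mul_of_nonneg_left hfar (by linarith)
  nlinarith

/-- The size of the signed along box's half-width at the (ζ′) y′-face tuple: `qB3YA (RA′) + (k+1)·RA′ + n_L ≤ 4·n_L` (`k + 1 ≤ 1000·Kq`, `2000·Kq·(RA′+2) ≤ n_L`). [folklore] -/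
theorem xSBox_hw_le (hnA : 2000 * Neg.Kq κ * (RA' κ Φ t p D mk + 2) ≤ nL κ Φ t p D g f) {k : ℕ} (hk : k + 1 ≤ 1000 * Neg.Kq κ) :
    ((qB3YA κ Φ t p D g f (RA' κ Φ t p D mk) : ℕ) : ℤ) + ((k : ℤ) + 1) * (RA' κ Φ t p D mk : ℕ) + (nL κ Φ t p D g f : ℤ) ≤ 4 * (nL κ Φ t p D g f : ℤ) := by
  have hq3 : ((qB3YA κ Φ t p D g f (RA' κ Φ t p D mk) : ℕ) : ℤ) = 2 * (nL κ Φ t p D g f : ℤ) + 1000 * (Neg.Kq κ : ℤ) * (RA' κ Φ t p D mk : ℤ) := by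
    unfold qB3YA; push_cast; ring
  have hnA' : 2000 * (Neg.Kq κ : ℤ) * ((RA' κ Φ t p D mk : ℤ) + 2) ≤ (nL κ Φ t p D g f : ℤ) := by exact_mod_cast hnA
  have hk' : (k : ℤ) + 1 ≤ 1000 * (Neg.Kq κ : ℤ) := by exact_mod_cast hk
  have hR0 : (0 : ℤ) ≤ (RA' κ Φ t p D mk : ℤ) := Nat.cast_nonneg _
  have hKq : (1 : ℤ) ≤ (Neg.Kq κ : ℤ) := by exact_mod_cast Neg.one_le_Kq κ
  have h1 : ((k : ℤ) + 1) * (RA' κ Φ t p D mk : ℤ) ≤ (1000 * (Neg.Kq κ : ℤ)) * (RA' κ Φ t p D mk : ℤ) := mul_le_mul_of_nonneg_right hk' hR0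
  rw [hq3]
  nlinarith

/-- **`FT5` at the (ζ′) y′-face tuple** (`k₀ := 3`; `i` the transverse index): the lower axis-`0` reading of tangential region `k` (sign `σT`) is above `−fw`, given the
run-position fact `hlo : −fw + 10u₀ + 2 ≤ FcA yT + σT·u₀·k`. [cite: KozmaNitzan2024, §4 Lemma 12 (pp. 23–25)] -/
theorem FT5_YA (hN : EqNumL κ Φ t p D g f) (hκ : (hL κ Φ t p D g f).natAbs ≤ 10 * nL κ Φ t p D g f)
    (hnA : 2000 * Neg.Kq κ * (RA' κ Φ t p D mk + 2) ≤ nL κ Φ t p D g f) (hℓ : 22000 * Neg.Kq κ * (RA' κ Φ t p D mk + 2) ≤ ℓL κ Φ t p D g f)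
    (yT x z : Site 2) (i : Fin 2) {σT : ℤ} (hσT : σT = 1 ∨ σT = -1) {k : ℕ} (hk : k + 1 ≤ 1000 * Neg.Kq κ)
    (hlo : -(5 * ((fcellsA κ Φ t p D g f).r i : ℤ) - 4 - 3 - |z i - (fcellsA κ Φ t p D g f).cen x i|) + 10 * u₀A κ Φ t p D g f + 2 ≤
      FcA κ Φ t p D g f yT + σT * u₀A κ Φ t p D g f * (k : ℤ)) :
    (nL κ Φ t p D g f : ℤ) * modulus (nL κ Φ t p D g f) (hL κ Φ t p D g f) (vL κ Φ t p D g f) (vβL κ Φ t p D g f) *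
        (-(5 * ((fcellsA κ Φ t p D g f).r i : ℤ) - 4 - 3 - |z i - (fcellsA κ Φ t p D g f).cen x i|) - FcA κ Φ t p D g f yT) ≤
      u₀A κ Φ t p D g f * modulus (nL κ Φ t p D g f) (hL κ Φ t p D g f) (vL κ Φ t p D g f) (vβL κ Φ t p D g f) *
            xSLo (nL κ Φ t p D g f) (qB3YA κ Φ t p D g f (RA' κ Φ t p D mk)) (RA' κ Φ t p D mk) σT k -
          u₀A κ Φ t p D g f * (nL κ Φ t p D g f : ℤ) * (shearUnit (nL κ Φ t p D g f) (hL κ Φ t p D g f) : ℤ) *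
            (xBoxB (nL κ Φ t p D g f) (ℓL κ Φ t p D g f) (hL κ Φ t p D g f) (RA' κ Φ t p D mk) k + 1) -
        u₀A κ Φ t p D g f * (nL κ Φ t p D g f : ℤ) -
        (nL κ Φ t p D g f : ℤ) * modulus (nL κ Φ t p D g f) (hL κ Φ t p D g f) (vL κ Φ t p D g f) (vβL κ Φ t p D g f) := by
  obtain ⟨hn1, hℓ1⟩ := one_le_of_eqNumL κ Φ t p D g f hN
  have hm2 := two_le_modulus κ Φ t p D g f mk hN hℓ
  have hu : 1 ≤ u₀A κ Φ t p D g f := (units_eqA κ Φ t p D g f).2.2.2.2.2.2.1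
  have hn : (1 : ℤ) ≤ (nL κ Φ t p D g f : ℤ) := by exact_mod_cast hn1
  have hsl := slant_le κ Φ t p D g f mk hN hκ hℓ hk
    (mul_nonneg (by linarith : 0 ≤ u₀A κ Φ t p D g f) (by linarith : (0 : ℤ) ≤ (nL κ Φ t p D g f : ℤ)))
  have hQ := xSBox_hw_le κ Φ t p D g f mk hnA hk
  obtain ⟨eLo, -⟩ := xSBox_eq (nL κ Φ t p D g f) (qB3YA κ Φ t p D g f (RA' κ Φ t p D mk)) (RA' κ Φ t p D mk) k hσT
  rw [eLo]
  clear eLo hℓ hk hκ hnA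
  set n : ℤ := (nL κ Φ t p D g f : ℤ)
  set m := modulus (nL κ Φ t p D g f) (hL κ Φ t p D g f) (vL κ Φ t p D g f) (vβL κ Φ t p D g f)
  set u := u₀A κ Φ t p D g f
  set F := FcA κ Φ t p D g f yT
  set S := (shearUnit (nL κ Φ t p D g f) (hL κ Φ t p D g f) : ℤ) * (xBoxB (nL κ Φ t p D g f) (ℓL κ Φ t p D g f) (hL κ Φ t p D g f) (RA' κ Φ t p D mk) k + 1)
  set Q := ((qB3YA κ Φ t p D g f (RA' κ Φ t p D mk) : ℕ) : ℤ) + ((k : ℤ) + 1) * (RA' κ Φ t p D mk : ℕ) + n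
  set fw := 5 * ((fcellsA κ Φ t p D g f).r i : ℤ) - 4 - 3 - |z i - (fcellsA κ Φ t p D g f).cen x i|
  have hnm : 0 ≤ n * m := mul_nonneg (by linarith) (by linarith)
  have hum : 0 ≤ u * m := mul_nonneg (by linarith) (by linarith)
  have p1 : n * m * (-fw - F) ≤ n * m * (σT * u * (k : ℤ) - 10 * u - 2) := mul_le_mul_of_nonneg_left (by linarith) hnm
  have p2 : u * m * Q ≤ u * m * (4 * n) := mul_le_mul_of_nonneg_left hQ hum
  have p3 : u * n * 1 ≤ u * n * m := mul_le_mul_of_nonneg_left (by linarith) (mul_nonneg (by linarith) (by linarith))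
  have e1 : u * m * (σT * ((k : ℤ) * n) - Q) = n * m * (σT * u * (k : ℤ)) - u * m * Q := by ring
  rw [e1]
  nlinarith [p1, p2, p3, hsl, hnm, hum]

/-- **`FT6` at the (ζ′) y′-face tuple** (`k₀ := 3`): the upper axis-`0` reading of tangential region `k` is below `fw`, given
`hhi : FcA yT + σT·u₀·k + 10u₀ + 2 ≤ fw`. [cite: KozmaNitzan2024, §4 Lemma 12 (pp. 23–25)] -/
theorem FT6_YA (hN : EqNumL κ Φ t p D g f) (hκ : (hL κ Φ t p D g f).natAbs ≤ 10 * nL κ Φ t p D g f)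
    (hnA : 2000 * Neg.Kq κ * (RA' κ Φ t p D mk + 2) ≤ nL κ Φ t p D g f) (hℓ : 22000 * Neg.Kq κ * (RA' κ Φ t p D mk + 2) ≤ ℓL κ Φ t p D g f)
    (yT x z : Site 2) (i : Fin 2) {σT : ℤ} (hσT : σT = 1 ∨ σT = -1) {k : ℕ} (hk : k + 1 ≤ 1000 * Neg.Kq κ)
    (hhi : FcA κ Φ t p D g f yT + σT * u₀A κ Φ t p D g f * (k : ℤ) + 10 * u₀A κ Φ t p D g f + 2 ≤
      5 * ((fcellsA κ Φ t p D g f).r i : ℤ) - 4 - 3 - |z i - (fcellsA κ Φ t p D g f).cen x i|) :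
    (nL κ Φ t p D g f : ℤ) * modulus (nL κ Φ t p D g f) (hL κ Φ t p D g f) (vL κ Φ t p D g f) (vβL κ Φ t p D g f) * (FcA κ Φ t p D g f yT + 1) +
          u₀A κ Φ t p D g f * modulus (nL κ Φ t p D g f) (hL κ Φ t p D g f) (vL κ Φ t p D g f) (vβL κ Φ t p D g f) *
            xSHi (nL κ Φ t p D g f) (qB3YA κ Φ t p D g f (RA' κ Φ t p D mk)) (RA' κ Φ t p D mk) σT k +
        u₀A κ Φ t p D g f * (nL κ Φ t p D g f : ℤ) * (shearUnit (nL κ Φ t p D g f) (hL κ Φ t p D g f) : ℤ) *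
          (xBoxB (nL κ Φ t p D g f) (ℓL κ Φ t p D g f) (hL κ Φ t p D g f) (RA' κ Φ t p D mk) k + 1) ≤
      (nL κ Φ t p D g f : ℤ) * modulus (nL κ Φ t p D g f) (hL κ Φ t p D g f) (vL κ Φ t p D g f) (vβL κ Φ t p D g f) *
        (5 * ((fcellsA κ Φ t p D g f).r i : ℤ) - 4 - 3 - |z i - (fcellsA κ Φ t p D g f).cen x i|) := by
  obtain ⟨hn1, hℓ1⟩ := one_le_of_eqNumL κ Φ t p D g f hN
  have hm2 := two_le_modulus κ Φ t p D g f mk hN hℓ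
  have hu : 1 ≤ u₀A κ Φ t p D g f := (units_eqA κ Φ t p D g f).2.2.2.2.2.2.1
  have hn : (1 : ℤ) ≤ (nL κ Φ t p D g f : ℤ) := by exact_mod_cast hn1
  have hsl := slant_le κ Φ t p D g f mk hN hκ hℓ hk
    (mul_nonneg (by linarith : 0 ≤ u₀A κ Φ t p D g f) (by linarith : (0 : ℤ) ≤ (nL κ Φ t p D g f : ℤ)))
  have hQ := xSBox_hw_le κ Φ t p D g f mk hnA hk
  obtain ⟨-, eHi⟩ := xSBox_eq (nL κ Φ t p D g f) (qB3YA κ Φ t p D g f (RA' κ Φ t p D mk)) (RA' κ Φ t p D mk) k hσT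
  rw [eHi]
  clear eHi hℓ hk hκ hnA
  set n : ℤ := (nL κ Φ t p D g f : ℤ)
  set m := modulus (nL κ Φ t p D g f) (hL κ Φ t p D g f) (vL κ Φ t p D g f) (vβL κ Φ t p D g f)
  set u := u₀A κ Φ t p D g f
  set F := FcA κ Φ t p D g f yT
  set S := (shearUnit (nL κ Φ t p D g f) (hL κ Φ t p D g f) : ℤ) * (xBoxB (nL κ Φ t p D g f) (ℓL κ Φ t p D g f) (hL κ Φ t p D g f) (RA' κ Φ t p D mk) k + 1)
  set Q := ((qB3YA κ Φ t p D g f (RA' κ Φ t p D mk) : ℕ) : ℤ) + ((k : ℤ) + 1) * (RA' κ Φ t p D mk : ℕ) + n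
  set fw := 5 * ((fcellsA κ Φ t p D g f).r i : ℤ) - 4 - 3 - |z i - (fcellsA κ Φ t p D g f).cen x i|
  have hnm : 0 ≤ n * m := mul_nonneg (by linarith) (by linarith)
  have hum : 0 ≤ u * m := mul_nonneg (by linarith) (by linarith)
  have p1 : n * m * (F + σT * u * (k : ℤ) + 10 * u + 2) ≤ n * m * fw := mul_le_mul_of_nonneg_left hhi hnm
  have p2 : u * m * Q ≤ u * m * (4 * n) := mul_le_mul_of_nonneg_left hQ hum
  have e1 : u * m * (σT * ((k : ℤ) * n) + Q) = n * m * (σT * u * (k : ℤ)) + u * m * Q := by ring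
  rw [e1]
  nlinarith [p1, p2, hsl, hnm, hum]

end FloorsTY

end KS

end NegB

end PlanarSkeletonNeg

end Summit.CriticalPhenomena.PercolationContinuityZ3.Theorems.Transplant

end
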